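import Summits.BirchSwinnertonDyer.Rank1Residual.X11b.BDPRouteCyclotomicRecord
import HarnessLib

/-!
# Class X11b, route p2 × the cyclotomic lever: the (T2∗) residue read through the class-closure
# lane's EVIDENCE-labelled conjecture `ClassClosure.RelativeExceptionalLeadingTermAt` (Disegni's
# split display WITHOUT his hypothesis (∗)) — records with the residue typed by NAME (cell
# `b2b-bsdres`, sub-cell `multr1-p2`, gen 21)

HONEST FRAMING (verbatim, cell `b2b-bsdres`, run/shared/lean/b2b/bsd-rank1-residual/): the goal of
the cell is to DELETE the COMBINATION-SHAPED residual classes for ALL analytic-rank `≤ 1` curves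
over `ℚ` — "full BSD formula for every rank `≤ 1` curve in class `C`" assembled STRICTLY from
published theorems — so that the rank-`≤ 1` remainder becomes exactly the CONSTRUCTION-SHAPED
classes, which are TYPED (missing-input Props), NOT attempted; this is not "finishing BSD".
Research route `p2` for class X11b; no claim beyond the stated class and loci; nothing booked; X11b
stays CONSTRUCTION-SHAPED. THEOREMS ONLY (no definition, no named fact, no `sorry`). CONDITIONAL on
the published named facts listed, on THE open input where stated, on the per-pair regulator input,
and — on the (T2∗) pairs — on the UNPROVED conjecture `ClassClosure.RelativeExceptionalLeadingTermAt`
(`@[conjecture]`, cc-typer-3, `X11b/ClassClosureTyped.lean`: Mazur–Tate–Teitelbaum's exceptional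
`p`-adic BSD leading term RELATIVE to the classical one in analytic rank one; IN PRINT only under
Disegni's (∗) = `p ≥ 5` + a second multiplicative prime; EVIDENCE = census X11-REPORT v3, 453/453
split rank-one rows incl. 44 rows at `p ≥ 5` without a second multiplicative prime and 150/150 at
`p = 3`; NOT a fact, NOT booked).

## What this file does

`X11b/BDPRouteCyclotomicRecord.lean` (gen 21) leaves on the ¬(ram) atom the residue (T2∗): pairs
split at `p` with `p` the ONLY multiplicative prime (55 089 ‖ 3 326 surjective class-wide pairs at
`p ≥ 5`), where Disegni's exact split formula is not in print, typed wholesale as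
`Typed.MissingUpperBoundAt`. Here that residue is typed by NAME, as the lane's conjecture:
* §1 `finite_sha_and_padicValNat_shaOrder_le_of_katoSurj_split_of_relativeLeadingTerm` /
  `missingUpperBoundAt_…` — at a SPLIT multiplicative `p ≠ 2` (ANY odd `p`, so `p = 3` too), onto
  `p`-adic image: the Euler-system half from Kato's divisibility + SW Thm. 6.1 + SW §4.2 + GZK +
  modularity + `RelativeExceptionalLeadingTermAt W p` + `SchneiderConjecture` for THE datum — no
  second multiplicative prime, no `p ≥ 5`.
* §2 `P2.bsdp_of_surj_split_of_relativeLeadingTerm` (`p ≥ 5`, with THE open input) and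
  `P2.bsdp_of_surj_split_odd_of_relativeLeadingTerm` (any odd `p`, `P2OpenInputOnTreeOddAt`,
  explicit `ρ̄_{E,p^n}` onto).
* §3 RECORDS: `P2.bsdp_of_onTree_cyclotomic_exceptional` — `∀ (E,p) ∈` X11b, `p ≥ 5 → BSD(E,p)`
  from published facts + THE open input + (REG) per pair + the conjecture
  `RelativeExceptionalLeadingTermAt W p` demanded ONLY on split pairs with no second multiplicative
  prime + (T4′) the corner; `bsdp_of_classX11b_five_twoRoads_exceptional` — with Skinner 2016 Thm. A
  on (ram): open input ONLY on ¬(ram) ∧ surj, conjecture ONLY on ¬(ram) ∧ split ∧ `p`-only.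
So X11b at `p ≥ 5` = published facts + {THE open input on ¬(ram) ∧ surj (112 175 pairs, 4.9 %);
REG per pair (Schneider); `RelativeExceptionalLeadingTermAt` on 55 089 pairs (2.4 %, census-evidenced);
(T4′) on 64 pairs}. CONDITIONAL; nothing booked; labels UNCHANGED; X11b stays CONSTRUCTION-SHAPED.

References: [Disegni2020] Thm. 1, Thm. 4, (∗); [Venerucci2015] Thm. D; [MazurTateTeitelbaum1986Invent]
§II.10; [Wuthrich2014] Thm. 3; [SteinWuthrich2013] Thm. 6.1, §4.2; [Skinner2016PacificMC] Thm. A;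
[Miller2011LMS] Def. 1.1.
-/

set_option autoImplicit false

noncomputable section

open scoped Classical MatrixGroups ModularForm

open CongruenceSubgroup WeierstrassCurve NumberField IsDedekindDomain Field
open Literature.NumberTheory.EllipticCurves Literature.NumberTheory.EllipticCurves.GreenbergSelmer
  Literature.NumberTheory.EllipticCurves.ModularForms
  Literature.NumberTheory.EllipticCurves.Rank1Residual
  Literature.NumberTheory.EllipticCurves.Rank1Residual.Typed
  Literature.NumberTheory.EllipticCurves.Wuthrich2014
  Literature.NumberTheory.EllipticCurves.SteinWuthrich2013
  Literature.NumberTheory.EllipticCurves.Disegni2020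
  Literature.NumberTheory.EllipticCurves.Skinner2016
  Literature.NumberTheory.EllipticCurves.BalakrishnanEtAl2019
  Literature.NumberTheory.QuadraticFields.Quadratic
  Literature.NumberTheory.Automorphic
  Literature.NumberTheory.GaloisRepresentations Literature.NumberTheory.GaloisCohomology

namespace Summit.BirchSwinnertonDyer.Rank1Residual.X11b

/-! ### §1. The Euler-system half at a split prime from the exceptional conjecture -/

section Split

variable (W : WeierstrassCurve ℚ) [W.IsElliptic] [W.IsGloballyMinimal] (p : ℕ) [Fact p.Prime]

/-- **The Euler-system half at a SPLIT multiplicative `p ≠ 2` (any odd `p`), onto `p`-adic image,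
from Kato's divisibility + Jones + the exceptional CONJECTURE + ONE `p`-adic height.** As
`finite_sha_and_padicValNat_shaOrder_le_of_katoSurj_split_of_schneider` with Disegni's split clause
(hypothesis (∗): `p ≥ 5`, a second multiplicative prime) REPLACED by the lane's conjecture
`ClassClosure.RelativeExceptionalLeadingTermAt W p` (`hC`; the same display, unit `u`; in print under
(∗), census-evidenced beyond). CONDITIONAL on an unproved conjecture; nothing booked.
[cite: Wuthrich2014, Thm. 3 (p. 383)] [cite: SteinWuthrich2013, Thm. 6.1 (p. 20), §4.2]
[cite: Disegni2020, Thm. 4 second bullet (§3.2)] [cite: MazurTateTeitelbaum1986Invent, §II.10]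
[cite: Miller2011LMS, Def. 1.1] -/
theorem finite_sha_and_padicValNat_shaOrder_le_of_katoSurj_split_of_relativeLeadingTerm
    (hK : kato_charIdeal_dvd_multiplicative_of_surjective) (hJ : thm61_splitMultiplicative)
    (hH : exists_isSplitMultCanonical)
    (hGZK : rank_eq_analyticRank_of_analyticRank_le_one)
    (hpar : nonempty_modularParametrizationData)
    (hp : p ≠ 2) (hmult : W.HasMultiplicativeReductionAtPrime p)
    (hsplit : W.HasSplitMultiplicativeReductionAtPrime p) (hr : W.analyticRank = 1)
    (hρ : ∀ n : ℕ, W.HasSurjectiveModNGaloisRep (p ^ n : ℕ))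
    (hC : ClassClosure.RelativeExceptionalLeadingTermAt W p)
    (hSch : ∀ (Dq : TateParameterData W p) (Dh : PAdicHeightData W p),
      IsSplitMultCanonical Dh Dq → SchneiderConjecture Dh)
    {s : ℚ} (hs : shaAn W = (s : ℂ)) :
    Finite W.sha ∧ (padicValNat p W.shaOrder : ℤ) ≤ padicValRat p s := by
  obtain ⟨κ, hκ, γ, hγ, hγ'⟩ := exists_isCyclotomic_isTopGenerator_isCyclotomicVariable_holds p
  obtain ⟨D⟩ := W.nonempty_selmerDualData_holds κ γ hγ
  haveI : NeZero (W.conductorNorm ℤ) := ⟨(W.conductorNorm_pos_holds).ne'⟩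
  obtain ⟨Dm⟩ := hpar W
  obtain ⟨ϖ, hϖpos, hϖ, -⟩ := Dm.exists_rat_mul_realPeriodRat_eq_plusPeriod
  obtain ⟨L, hL⟩ := exists_isSplitMultPAdicLFunctionOf hsplit Dm.isNewformOf
  obtain ⟨Dq⟩ := (nonempty_tateParameterData_iff_holds (W := W) (p := p)).mpr hsplit
  obtain ⟨Dh, hDh⟩ := hH W p hp Dq
  -- Kato's divisibility for this data (split clause: `ι(T·g') = ϖ·L`)
  obtain ⟨hXt, -, hsp⟩ := hK W p hp hmult hρ hκ hγ hγ' Dm.isNewformOf D ϖ hϖ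
  obtain ⟨g', hg', hdiv'⟩ := hsp hsplit L hL
  obtain ⟨g, hg⟩ := (charIdeal_isPrincipal_holds p D.X).principal
  have hchar : D.charIdeal = Ideal.span {g} := hg
  rw [hchar] at hg'
  obtain ⟨h, hgh⟩ := Ideal.mem_span_singleton'.mp hg'
  have hdiv : iwasawaToPowerSeries p ((PowerSeries.X : IwasawaAlgebra p) * g * h) =
      PowerSeries.C ((ϖ : ℚ) : ℚ_[p]) * L := by
    rw [show (PowerSeries.X : IwasawaAlgebra p) * g * h = PowerSeries.X * g' by rw [← hgh]; ring]
    exact hdiv'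
  -- the exceptional display at the pair, from the conjecture
  obtain ⟨s', u', hs', hDis⟩ := hC hp hsplit hr Dm.isNewformOf ϖ hϖpos.ne' hϖ Dq L hL Dh hDh
  have hss : s' = s := by exact_mod_cast hs'.symm.trans hs
  subst hss
  exact finite_sha_and_padicValNat_shaOrder_le_of_split_divisibility W p hJ hGZK hp hr Dq hκ hγ hγ' D
    hXt hchar h hdiv Dh hDh hs u' hDis (hSch Dq Dh hDh)

/-- `Typed.MissingUpperBoundAt` packaging of
`finite_sha_and_padicValNat_shaOrder_le_of_katoSurj_split_of_relativeLeadingTerm`. CONDITIONAL on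
the conjecture; nothing booked. [cite: MazurTateTeitelbaum1986Invent, §II.10] [cite: Miller2011LMS, Def. 1.1] -/
theorem missingUpperBoundAt_of_katoSurj_split_of_relativeLeadingTerm
    (hK : kato_charIdeal_dvd_multiplicative_of_surjective) (hJ : thm61_splitMultiplicative)
    (hH : exists_isSplitMultCanonical)
    (hGZK : rank_eq_analyticRank_of_analyticRank_le_one)
    (hpar : nonempty_modularParametrizationData)
    (hp : p ≠ 2) (hmult : W.HasMultiplicativeReductionAtPrime p)
    (hsplit : W.HasSplitMultiplicativeReductionAtPrime p) (hr : W.analyticRank = 1)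
    (hρ : ∀ n : ℕ, W.HasSurjectiveModNGaloisRep (p ^ n : ℕ))
    (hC : ClassClosure.RelativeExceptionalLeadingTermAt W p)
    (hSch : ∀ (Dq : TateParameterData W p) (Dh : PAdicHeightData W p),
      IsSplitMultCanonical Dh Dq → SchneiderConjecture Dh) :
    Typed.MissingUpperBoundAt W p := by
  haveI : NeZero (W.conductorNorm ℤ) := ⟨(W.conductorNorm_pos_holds).ne'⟩
  obtain ⟨Dm⟩ := hpar W
  obtain ⟨ϖ, hϖpos, hϖ, -⟩ := Dm.exists_rat_mul_realPeriodRat_eq_plusPeriod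
  obtain ⟨L, hL⟩ := exists_isSplitMultPAdicLFunctionOf hsplit Dm.isNewformOf
  obtain ⟨Dq⟩ := (nonempty_tateParameterData_iff_holds (W := W) (p := p)).mpr hsplit
  obtain ⟨Dh, hDh⟩ := hH W p hp Dq
  obtain ⟨s, -, hs, -⟩ := hC hp hsplit hr Dm.isNewformOf ϖ hϖpos.ne' hϖ Dq L hL Dh hDh
  exact ⟨s, hs, (finite_sha_and_padicValNat_shaOrder_le_of_katoSurj_split_of_relativeLeadingTerm W p
    hK hJ hH hGZK hpar hp hmult hsplit hr hρ hC hSch hs).2⟩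

end Split

/-! ### §2. Route p2 on the (T2∗) pairs -/

section RouteP2

variable (W : WeierstrassCurve ℚ) [W.IsElliptic] [W.IsGloballyMinimal] (p : ℕ) [Fact p.Prime]

/-- **Route p2 on a split pair WITHOUT a second multiplicative prime, `p ≥ 5`** (the (T2∗) residue,
55 089 ‖ 3 326 surjective class-wide pairs): `BSD(E,p)` ⇐ the route's published facts + THE open
input at the pair + the lever's facts + `RegulatorNonvanishingAt W p` + the CONJECTURE
`RelativeExceptionalLeadingTermAt W p`. CONDITIONAL on two unproved statements (the open input, the
conjecture) and the per-pair regulator input; nothing booked. [cite: Disegni2020, Thm. 4, (∗)]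
[cite: MazurTateTeitelbaum1986Invent, §II.10] [cite: Castella2018Erratum, (2.4)] [cite: Miller2011LMS, Def. 1.1] -/
theorem P2.bsdp_of_surj_split_of_relativeLeadingTerm
    (hGZ : ∀ (N : ℕ) [NeZero N] (W : WeierstrassCurve ℚ) (K : Type) [Field K] [NumberField K],
      gross_zagier N W K)
    (hKo : ∀ (N : ℕ) [NeZero N] (W : WeierstrassCurve ℚ) (K : Type) [Field K] [NumberField K],
      kolyvagin N W K)
    (hWu : sha_dvd_analyticSha)
    (hGZK : rank_eq_analyticRank_of_analyticRank_le_one) (hmod : hasEntireLFunction_rat)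
    (hnf : exists_isNewformOf) (hHL : HoffsteinLuo1997_exists_twist_L_one_ne_zero)
    (hMaz : mazur_not_dvd_maninConstant_of_odd)
    (hPT : ∀ (K : Type) [Field K] [NumberField K], poitouTate_sum_localTatePairing_eq_zero K)
    (hEP : ∀ (K : Type) [Field K] [NumberField K] (v : HeightOneSpectrum (𝓞 K)),
      localEulerPoincareCharacteristic (v.adicCompletion K))
    (hK : kato_charIdeal_dvd_multiplicative_of_surjective) (hJs : thm61_splitMultiplicative)
    (hHs : exists_isSplitMultCanonical) (hpar : nonempty_modularParametrizationData)
    (hA : P2OpenInputOnTreeAt W p) (hReg : ClassClosure.RegulatorNonvanishingAt W p)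
    (hC : ClassClosure.RelativeExceptionalLeadingTermAt W p)
    (hX : ClassX11b W p) (hp5 : 5 ≤ p) (hsurj : Surj W p)
    (hsplit : W.HasSplitMultiplicativeReductionAtPrime p) : BSDp W p :=
  P2.bsdp_of_surj_of_missingUpperBoundAt_endState W p hGZ hKo hWu hGZK hmod hnf hHL hMaz hPT hEP hA
    (missingUpperBoundAt_of_katoSurj_split_of_relativeLeadingTerm W p hK hJs hHs hGZK hpar hX.2.1
      hX.2.2.1 hsplit hX.1
      (kato_charIdeal_dvd_multiplicative_of_surjective.surjective_pow_of_five_le W p hp5 hsurj) hC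
      hReg.2)
    hX hp5 hsurj

/-- **The same at ANY ODD `p` (so `p = 3`)** with the odd open input `P2OpenInputOnTreeOddAt W p` and
an explicit onto-`p`-adic-image hypothesis `hρ` (at `p = 3` a mod-`9` certificate). On X11b@3 this
is the ¬(ram) ∧ split-at-`3` atom's road (team x11b3's S2c/(T2γ) bookkeeping aside): StepL@3 +
REG3 + the exceptional conjecture at `3`. CONDITIONAL on three unproved inputs; nothing booked.
[cite: MazurTateTeitelbaum1986Invent, §II.10] [cite: Miller2011LMS, Def. 1.1] -/
theorem P2.bsdp_of_surj_split_odd_of_relativeLeadingTerm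
    (hGZ : ∀ (N : ℕ) [NeZero N] (W : WeierstrassCurve ℚ) (K : Type) [Field K] [NumberField K],
      gross_zagier N W K)
    (hKo : ∀ (N : ℕ) [NeZero N] (W : WeierstrassCurve ℚ) (K : Type) [Field K] [NumberField K],
      kolyvagin N W K)
    (hWu : sha_dvd_analyticSha)
    (hGZK : rank_eq_analyticRank_of_analyticRank_le_one) (hmod : hasEntireLFunction_rat)
    (hnf : exists_isNewformOf) (hHL : HoffsteinLuo1997_exists_twist_L_one_ne_zero)
    (hMaz : mazur_not_dvd_maninConstant_of_odd)
    (hPT : ∀ (K : Type) [Field K] [NumberField K], poitouTate_sum_localTatePairing_eq_zero K)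
    (hEP : ∀ (K : Type) [Field K] [NumberField K] (v : HeightOneSpectrum (𝓞 K)),
      localEulerPoincareCharacteristic (v.adicCompletion K))
    (hK : kato_charIdeal_dvd_multiplicative_of_surjective) (hJs : thm61_splitMultiplicative)
    (hHs : exists_isSplitMultCanonical) (hpar : nonempty_modularParametrizationData)
    (hA : P2OpenInputOnTreeOddAt W p)
    (hX : ClassX11b W p) (hsurj : Surj W p)
    (hρ : ∀ n : ℕ, W.HasSurjectiveModNGaloisRep (p ^ n : ℕ))
    (hsplit : W.HasSplitMultiplicativeReductionAtPrime p)
    (hC : ClassClosure.RelativeExceptionalLeadingTermAt W p)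
    (hSch : ∀ (Dq : TateParameterData W p) (Dh : PAdicHeightData W p),
      IsSplitMultCanonical Dh Dq → SchneiderConjecture Dh) : BSDp W p :=
  Typed.bsdp_of_missingPPartAt W p hGZK (by rw [hX.1])
    (Typed.missingPPartAt_of_lower_of_upper W p
      (P2.missingLowerBoundAt_of_openInputOddAt W p hGZ hKo hWu hGZK hmod hnf hHL hMaz hPT hEP hA hX
        hsurj)
      (missingUpperBoundAt_of_katoSurj_split_of_relativeLeadingTerm W p hK hJs hHs hGZK hpar hX.2.1
        hX.2.2.1 hsplit hX.1 hρ hC hSch))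

end RouteP2

/-! ### §3. Records with the (T2∗) residue typed by name -/

/-- **Route p2 — STATEMENT OF RECORD, the (T2∗) residue typed BY NAME (gen 21).** `∀ (E, p) ∈`
X11b, `p ≥ 5 → BSD(E, p)` from route p2's and the lever's published named facts and the typed inputs:
(T1) THE open input `P2OpenInputOnTreeAt` [UNREFEREED: erratum (2.4) ⇐ FW21 4.41]; (REG)
`ClassClosure.RegulatorNonvanishingAt` per pair [certificate / Schneider's conjecture]; (T2∗)
`ClassClosure.RelativeExceptionalLeadingTermAt W p` ONLY on the pairs split at `p` with NO second
multiplicative prime [CONJECTURE, census-evidenced; 55 117 ‖ 3 328 class-wide pairs, all ¬(ram)];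
(T4′) the localised corner [64 ‖ 5]. Compared with `P2.bsdp_of_onTree_cyclotomic` the wholesale
`Typed.MissingUpperBoundAt` on (T2∗) is replaced by the NAMED analytic identity it follows from.
CONDITIONAL; nothing booked; labels UNCHANGED; X11b stays CONSTRUCTION-SHAPED.
[cite: Disegni2020, Thm. 1 (§1.2), Thm. 4, (∗)] [cite: MazurTateTeitelbaum1986Invent, §II.10]
[cite: Wuthrich2014, Thm. 3 (p. 383), Prop. 21 (p. 400)] [cite: SteinWuthrich2013, Thm. 6.1, §4.2]
[cite: Castella2018, Thm. 2.3, Thm. 3.2] [cite: Castella2018Erratum, (2.4)] [cite: Miller2011LMS, Def. 1.1] -/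
theorem P2.bsdp_of_onTree_cyclotomic_exceptional
    -- route p2's published inputs
    (hGZ : ∀ (N : ℕ) [NeZero N] (W : WeierstrassCurve ℚ) (K : Type) [Field K] [NumberField K],
      gross_zagier N W K)
    (hKo : ∀ (N : ℕ) [NeZero N] (W : WeierstrassCurve ℚ) (K : Type) [Field K] [NumberField K],
      kolyvagin N W K)
    (hWu : sha_dvd_analyticSha)
    (hGZK : rank_eq_analyticRank_of_analyticRank_le_one) (hmod : hasEntireLFunction_rat)
    (hnf : exists_isNewformOf) (hHL : HoffsteinLuo1997_exists_twist_L_one_ne_zero)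
    (hMaz : mazur_not_dvd_maninConstant_of_odd)
    (hBDMTV : thm12_not_le_normalizer_splitCartan)
    (hPT : ∀ (K : Type) [Field K] [NumberField K], poitouTate_sum_localTatePairing_eq_zero K)
    (hEP : ∀ (K : Type) [Field K] [NumberField K] (v : HeightOneSpectrum (𝓞 K)),
      localEulerPoincareCharacteristic (v.adicCompletion K))
    -- the lever's published inputs
    (hK : kato_charIdeal_dvd_multiplicative_of_surjective)
    (hJn : thm61_nonsplitMultiplicative) (hJs : thm61_splitMultiplicative)
    (hHn : exists_isMultCanonical) (hHs : exists_isSplitMultCanonical)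
    (hD : thm1_padicBSD_rankOne_multiplicative) (hpar : nonempty_modularParametrizationData)
    -- (T1) THE open input
    (hA : ∀ (W : WeierstrassCurve ℚ) [W.IsElliptic] [W.IsGloballyMinimal] (p : ℕ) [Fact p.Prime],
      P2OpenInputOnTreeAt W p)
    -- (REG)
    (hReg : ∀ (W : WeierstrassCurve ℚ) [W.IsElliptic] [W.IsGloballyMinimal] (p : ℕ) [Fact p.Prime],
      ClassX11b W p → 5 ≤ p → ClassClosure.RegulatorNonvanishingAt W p)
    -- (T2∗) the exceptional conjecture, only off Disegni's (∗)
    (hC : ∀ (W : WeierstrassCurve ℚ) [W.IsElliptic] [W.IsGloballyMinimal] (p : ℕ) [Fact p.Prime],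
      ClassX11b W p → 5 ≤ p → W.HasSplitMultiplicativeReductionAtPrime p →
      (¬ ∃ (m : ℕ) (_ : Fact m.Prime), m ≠ p ∧ W.HasMultiplicativeReductionAtPrime m) →
      ClassClosure.RelativeExceptionalLeadingTermAt W p)
    -- (T4′)
    (hCorner : ∀ (W : WeierstrassCurve ℚ) [W.IsElliptic] [W.IsGloballyMinimal] (p : ℕ)
      [Fact p.Prime], ClassX11b W p → ¬ Surj W p → (p = 5 ∨ p = 7) →
        p ∣ padicValInt p W.minimalDiscriminantInt → ¬ Ram W p → Typed.MissingPPartAt W p)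
    (W : WeierstrassCurve ℚ) [W.IsElliptic] [W.IsGloballyMinimal] (p : ℕ) [Fact p.Prime]
    (hX : ClassX11b W p) (hp5 : 5 ≤ p) : BSDp W p := by
  refine P2.bsdp_of_onTree_cyclotomic hGZ hKo hWu hGZK hmod hnf hHL hMaz hBDMTV hPT hEP hK hJn hJs hHn
    hHs hD hpar hA hReg ?_ hCorner W p hX hp5
  intro W _ _ p _ hX hp5 hsplit hm
  have hp2 : p ≠ 2 := hX.2.1
  by_cases hsurj : Surj W p
  · exact missingUpperBoundAt_of_katoSurj_split_of_relativeLeadingTerm W p hK hJs hHs hGZK hpar hp2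
      hX.2.2.1 hsplit hX.1
      (kato_charIdeal_dvd_multiplicative_of_surjective.surjective_pow_of_five_le W p hp5 hsurj)
      (hC W p hX hp5 hsplit hm) (hReg W p hX hp5).2
  · -- non-surjective: the corner input gives the whole `p`-part, a fortiori the upper half
    obtain ⟨h57, hdvd, hnram⟩ := ClassX11b.not_surj_shape W p hBDMTV hX hp5 hsurj
    exact (Typed.lower_and_upper_of_missingPPartAt W p (hCorner W p hX hsurj h57 hdvd hnram)).2

/-- **X11b at `p ≥ 5`, THE TWO ROADS, every residue typed by name.** `∀ (E, p) ∈` X11b,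
`p ≥ 5 → BSD(E, p)` from published named facts (route p2's eleven, the lever's seven, Skinner 2016
Thm. A) and: (REG) per pair everywhere; THE open input ONLY on ¬(ram) ∧ surj pairs (112 175, 4.9 %);
the conjecture `RelativeExceptionalLeadingTermAt W p` ONLY on ¬(ram) pairs split at `p` with no
second multiplicative prime (55 117; 55 089 surjective); (T4′) the corner (64). CONDITIONAL; nothing
booked; labels UNCHANGED; X11b stays CONSTRUCTION-SHAPED. [cite: Skinner2016PacificMC, Thm. A (§1)]
[cite: Disegni2020, Thm. 1 (§1.2), (∗)] [cite: MazurTateTeitelbaum1986Invent, §II.10]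
[cite: Castella2018Erratum, (2.4)] [cite: Miller2011LMS, Def. 1.1] -/
theorem bsdp_of_classX11b_five_twoRoads_exceptional
    (hGZ : ∀ (N : ℕ) [NeZero N] (W : WeierstrassCurve ℚ) (K : Type) [Field K] [NumberField K],
      gross_zagier N W K)
    (hKo : ∀ (N : ℕ) [NeZero N] (W : WeierstrassCurve ℚ) (K : Type) [Field K] [NumberField K],
      kolyvagin N W K)
    (hWu : sha_dvd_analyticSha)
    (hGZK : rank_eq_analyticRank_of_analyticRank_le_one) (hmod : hasEntireLFunction_rat)
    (hnf : exists_isNewformOf) (hHL : HoffsteinLuo1997_exists_twist_L_one_ne_zero)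
    (hMaz : mazur_not_dvd_maninConstant_of_odd)
    (hBDMTV : thm12_not_le_normalizer_splitCartan)
    (hPT : ∀ (K : Type) [Field K] [NumberField K], poitouTate_sum_localTatePairing_eq_zero K)
    (hEP : ∀ (K : Type) [Field K] [NumberField K] (v : HeightOneSpectrum (𝓞 K)),
      localEulerPoincareCharacteristic (v.adicCompletion K))
    (hSkA : thmA_charIdeal_multiplicative)
    (hK : kato_charIdeal_dvd_multiplicative_of_surjective)
    (hJn : thm61_nonsplitMultiplicative) (hJs : thm61_splitMultiplicative)
    (hHn : exists_isMultCanonical) (hHs : exists_isSplitMultCanonical)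
    (hD : thm1_padicBSD_rankOne_multiplicative) (hpar : nonempty_modularParametrizationData)
    (hA : ∀ (W : WeierstrassCurve ℚ) [W.IsElliptic] [W.IsGloballyMinimal] (p : ℕ) [Fact p.Prime],
      ClassX11b W p → 5 ≤ p → ¬ Ram W p → Surj W p → P2OpenInputOnTreeAt W p)
    (hReg : ∀ (W : WeierstrassCurve ℚ) [W.IsElliptic] [W.IsGloballyMinimal] (p : ℕ) [Fact p.Prime],
      ClassX11b W p → 5 ≤ p → ClassClosure.RegulatorNonvanishingAt W p)
    (hC : ∀ (W : WeierstrassCurve ℚ) [W.IsElliptic] [W.IsGloballyMinimal] (p : ℕ) [Fact p.Prime],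
      ClassX11b W p → 5 ≤ p → ¬ Ram W p → W.HasSplitMultiplicativeReductionAtPrime p →
      (¬ ∃ (m : ℕ) (_ : Fact m.Prime), m ≠ p ∧ W.HasMultiplicativeReductionAtPrime m) →
      ClassClosure.RelativeExceptionalLeadingTermAt W p)
    (hCorner : ∀ (W : WeierstrassCurve ℚ) [W.IsElliptic] [W.IsGloballyMinimal] (p : ℕ)
      [Fact p.Prime], ClassX11b W p → ¬ Surj W p → (p = 5 ∨ p = 7) →
        p ∣ padicValInt p W.minimalDiscriminantInt → ¬ Ram W p → Typed.MissingPPartAt W p)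
    (W : WeierstrassCurve ℚ) [W.IsElliptic] [W.IsGloballyMinimal] (p : ℕ) [Fact p.Prime]
    (hX : ClassX11b W p) (hp5 : 5 ≤ p) : BSDp W p := by
  refine bsdp_of_classX11b_five_twoRoads hGZ hKo hWu hGZK hmod hnf hHL hMaz hBDMTV hPT hEP hSkA hK hJn
    hJs hHn hHs hD hpar hA hReg ?_ hCorner W p hX hp5
  intro W _ _ p _ hX hp5 hnram hsplit hm
  by_cases hsurj : Surj W p
  · exact missingUpperBoundAt_of_katoSurj_split_of_relativeLeadingTerm W p hK hJs hHs hGZK hpar hX.2.1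
      hX.2.2.1 hsplit hX.1
      (kato_charIdeal_dvd_multiplicative_of_surjective.surjective_pow_of_five_le W p hp5 hsurj)
      (hC W p hX hp5 hnram hsplit hm) (hReg W p hX hp5).2
  · obtain ⟨h57, hdvd, hnram'⟩ := ClassX11b.not_surj_shape W p hBDMTV hX hp5 hsurj
    exact (Typed.lower_and_upper_of_missingPPartAt W p (hCorner W p hX hsurj h57 hdvd hnram')).2

end Summit.BirchSwinnertonDyer.Rank1Residual.X11b

end
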